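import Mathlib.RingTheory.AlgebraicIndependent.TranscendenceBasis
import Mathlib.RingTheory.AlgebraicIndependent.AlgebraicClosure
import Mathlib.RingTheory.Algebraic.Integral
import Mathlib.FieldTheory.IntermediateField.Adjoin.Basic
import Mathlib.LinearAlgebra.FiniteDimensional.Defs
import Mathlib.LinearAlgebra.Dimension.Finrank
import Mathlib.LinearAlgebra.Isomorphisms
import Mathlib.LinearAlgebra.FiniteDimensional.Lemmas
import Mathlib.LinearAlgebra.Dimension.RankNullity
import Mathlib.LinearAlgebra.Dimension.Constructions
import Mathlib.LinearAlgebra.Dimension.Finite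
import Mathlib.LinearAlgebra.Quotient.Basic
import Mathlib.RingTheory.Finiteness.Basic
import Mathlib.RingTheory.Noetherian.Basic
import Literature.Combinatorics.Matroid.RelRank
import Literature.ModelTheory.ExponentialFields.ExponentialField
import HarnessLib

/-!
# Γ-fields inside an exponential field: predimension and strong subfields (Bays–Kirby §3–4)

M. Bays and J. Kirby, *Pseudo-exponential maps, variants, and quasiminimality*, Algebra &
Number Theory 12 (2018) 493–549 (arXiv:1512.04262), §§3–4, develop the Hrushovski-style algebra
of *Γ-fields*: fields `A` with a divisible subgroup `Γ(A) ≤ G(A)`, `G = G₁ × G₂`, the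
predimension `δ(X/A) = td(X/A) - d · ldim_{k_𝒪}(Γ(X)/Γ(A))` (Def. 4.1), strong extensions
`A ◁ B` (Def. 4.3), Γ-closed subfields `A ◁_cl F` (Def. 4.9) and the resulting pregeometry.

This file specialises this vocabulary to the **exponential case inside a fixed exponential field**
`F` (case (EXP) of Def. 3.6 with `d = 1`, `G₁ = 𝔾ₐ`, `G₂ = 𝔾ₘ`, `𝒪 = ℤ`, `k_𝒪 = ℚ`, `Γ(F)` the
graph of `exp`), which is all that is needed for `ℂ_exp` (Bays–Kirby Thm 1.5, Cor. 11.7): a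
kernel-preserving Γ-subfield `A` of `F` is determined by the divisible subgroup
`Γ(A) = {(x, eˣ) : x ∈ Λ}` for a `ℚ`-subspace `Λ ≤ F` (Remark 3.11(4): "the Γ-field `A` is
determined by the submodule `Γ(A)`"), and `A` itself is the subfield `ℚ(Λ, exp Λ)` generated by
the coordinates of `Γ(A)` (Def. 3.8). Accordingly everything below is phrased in terms of
`Λ : Submodule ℚ F`.

## Contents

* `GammaField.ldim Λ Λ' = ldim_ℚ(Λ + Λ'/Λ)` (finite dimension of the image of `Λ'` in `F ⧸ Λ`)
  and `GammaField.IsFG Λ Λ'` (Def. 3.15: the extension `Λ ≤ Λ + Λ'` is finitely generated, i.e.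
  `Γ(B)/Γ(A)` has finite `ℚ`-linear dimension), with modularity `ldim_eq_ldim_inf` and the
  addition formula `ldim_add` — stated for subspaces of any vector space.
* `GammaField.acl s` (relative algebraic closure in `F`, the closure operator of Mathlib's
  algebraic matroid `AlgebraicIndependent.matroid ℚ F`), `GammaField.gens Λ = Λ ∪ exp '' Λ` and
  `GammaField.fieldOf Λ = ℚ(Λ, exp Λ)` (the Γ-subfield attached to `Λ`, Def. 3.8).
* `GammaField.td Λ Λ' = td(A A'/A)` (relative transcendence degree, as relative rank
  `Matroid.relRank` in the algebraic matroid, an `ℕ∞`) and the predimension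
  `GammaField.predim Λ Λ' = δ(A'/A) = td - ldim` (Def. 4.1), with Lemma 4.2: addition formula
  `predim_add` and submodularity `predim_sup_le`.
* `GammaField.IsStrong Λ` (Def. 4.3, `A ◁ F`) and `GammaField.IsGammaClosed Λ` (Def. 4.9,
  `A ◁_cl F`); Lemma 4.10 (1) (`IsGammaClosed.isStrong`), Lemma 4.8
  (`IsStrong.of_predim_eq_zero`), strong extensions by minimising `δ` and hulls (Def. 4.6,
  Lemma 4.5: `isStrong_of_forall_predim_le`, `isStrong_of_forall_predim_le_of_le`,
  `IsStrong.exists_isStrong_of_le`, `IsStrong.exists_isStrong`), simple extensions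
  (`td_span_singleton`, `not_mem_acl_of_td_eq_two`) and Lemma 4.13 in the form
  `IsStrong.sup_span_singleton`: adjoining `d ∉ H` (`H` Γ-closed, `D ◁ F`, `D ≤ H`) gives
  `D + ℚd ◁ F` with `δ(d/D) = 1`.

All statements are proved; nothing here is deep (transcendence degree is handled through the
relative rank of the algebraic matroid, `Matroid.relRank`, and `ℚ`-linear dimension through
quotient spaces). The comparison of `td` with the `Algebra.trdeg`-based relative transcendence
degree `Literature.NumberTheory.Transcendental.relTrdeg` of `EclPregeometry.lean` (Kirby's `td(x̄, exp x̄/C)`) is carried out in the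
sibling file relating this predimension to Kirby's `ecl`-pregeometry.

## References

* M. Bays, J. Kirby, *Pseudo-exponential maps, variants, and quasiminimality*, Algebra & Number
  Theory 12 (2018) 493–549, arXiv:1512.04262: Def. 3.8, Remark 3.11, Def. 3.15, Def. 4.1,
  Lemma 4.2, Def. 4.3, Lemma 4.5, Def. 4.6, Lemma 4.8, Def. 4.9, Lemma 4.10, Lemma 4.13.
* E. Hrushovski, *A new strongly minimal set*, Ann. Pure Appl. Logic 62 (1993) (predimensions).
-/

noncomputable section

open Set

namespace Literature.NumberTheory.Transcendental

/-! ### Small facts about exponential maps -/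

section ExponentialRing
open Literature.ModelTheory.ExponentialFields (ExponentialRing)
open Literature.ModelTheory.ExponentialFields.ExponentialRing

variable {R : Type*} [CommRing R] [ExponentialRing R]

/-- `exp x ≠ 0` in a nontrivial exponential ring. [folklore] -/
theorem _root_.Literature.ModelTheory.ExponentialFields.ExponentialRing.exp_ne_zero [Nontrivial R] (x : R) : exp x ≠ 0 :=
  (isUnit_exp x).ne_zero

/-- `exp (n • x) = (exp x) ^ n`. [folklore] -/
theorem _root_.Literature.ModelTheory.ExponentialFields.ExponentialRing.exp_nsmul (n : ℕ) (x : R) : exp (n • x) = exp x ^ n := by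
  induction n with
  | zero => simp
  | succ n ih => rw [succ_nsmul, exp_add, ih, pow_succ]

variable {F : Type*} [Field F] [ExponentialRing F]

/-- `exp (-x) = (exp x)⁻¹` in an exponential field. [folklore] -/
theorem _root_.Literature.ModelTheory.ExponentialFields.ExponentialRing.exp_neg_eq_inv (x : F) : exp (-x) = (exp x)⁻¹ :=
  eq_inv_of_mul_eq_one_right (exp_mul_exp_neg x)

/-- `exp (n • x) = (exp x) ^ n` for `n : ℤ`. [folklore] -/
theorem _root_.Literature.ModelTheory.ExponentialFields.ExponentialRing.exp_zsmul (n : ℤ) (x : F) : exp (n • x) = exp x ^ n := by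
  cases n with
  | ofNat n => rw [Int.ofNat_eq_natCast, natCast_zsmul, exp_nsmul, zpow_natCast]
  | negSucc n => rw [negSucc_zsmul, exp_neg_eq_inv, exp_nsmul, zpow_negSucc]

end ExponentialRing

namespace GammaField

open Literature.ModelTheory.ExponentialFields.ExponentialRing

/-! ### Relative linear dimension of `ℚ`-subspaces -/

section LinearDimension

variable {k V : Type*} [Field k] [AddCommGroup V] [Module k V]

/-- ldim(Λ'/Λ) := dim ((Λ + Λ')/Λ), the (finite) dimension of the image of `Λ'` in `V ⧸ Λ`. [folklore] -/
def ldim (Λ Λ' : Submodule k V) : ℕ :=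
  Module.finrank k ↥(Λ'.map Λ.mkQ)

/-- The extension `Λ ⊆ Λ + Λ'` is finitely generated: the image of `Λ'` in `V ⧸ Λ` is
finite-dimensional. [folklore] -/
def IsFG (Λ Λ' : Submodule k V) : Prop :=
  (Λ'.map Λ.mkQ).FG

variable {Λ Λ' Λ'' X Y : Submodule k V}

/-- `IsFG` as finite-dimensionality of the image in the quotient. [folklore] -/
theorem isFG_iff_finite : IsFG Λ Λ' ↔ Module.Finite k ↥(Λ'.map Λ.mkQ) :=
  (Module.Finite.iff_fg).symm

/-- The image of a finitely generated extension in the quotient is finite-dimensional. [folklore] -/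
theorem IsFG.finite (h : IsFG Λ Λ') : Module.Finite k ↥(Λ'.map Λ.mkQ) :=
  isFG_iff_finite.1 h

/-- `(Λ + Λ')/Λ = Λ'/Λ` inside `V ⧸ Λ`. [folklore] -/
theorem map_mkQ_sup_left (Λ Λ' : Submodule k V) : (Λ ⊔ Λ').map Λ.mkQ = Λ'.map Λ.mkQ := by
  rw [Submodule.map_sup, Submodule.mkQ_map_self, bot_sup_eq]

/-- `(Λ' + Λ)/Λ = Λ'/Λ` inside `V ⧸ Λ`. [folklore] -/
theorem map_mkQ_sup_right (Λ Λ' : Submodule k V) : (Λ' ⊔ Λ).map Λ.mkQ = Λ'.map Λ.mkQ := by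
  rw [sup_comm, map_mkQ_sup_left]

/-- `ldim(Λ + Λ'/Λ) = ldim(Λ'/Λ)`. [folklore] -/
@[simp] theorem ldim_sup_left (Λ Λ' : Submodule k V) : ldim Λ (Λ ⊔ Λ') = ldim Λ Λ' := by
  rw [ldim, ldim, map_mkQ_sup_left]

/-- `ldim(Λ' + Λ/Λ) = ldim(Λ'/Λ)`. [folklore] -/
@[simp] theorem ldim_sup_right (Λ Λ' : Submodule k V) : ldim Λ (Λ' ⊔ Λ) = ldim Λ Λ' := by
  rw [sup_comm, ldim_sup_left]

/-- `Λ + Λ'` is finitely generated over `Λ` iff `Λ'` is. [folklore] -/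
@[simp] theorem isFG_sup_left : IsFG Λ (Λ ⊔ Λ') ↔ IsFG Λ Λ' := by
  rw [IsFG, IsFG, map_mkQ_sup_left]

/-- `Λ' + Λ` is finitely generated over `Λ` iff `Λ'` is. [folklore] -/
@[simp] theorem isFG_sup_right : IsFG Λ (Λ' ⊔ Λ) ↔ IsFG Λ Λ' := by
  rw [sup_comm, isFG_sup_left]

/-- `ldim(Λ/Λ) = 0`. [folklore] -/
@[simp] theorem ldim_self (Λ : Submodule k V) : ldim Λ Λ = 0 := by
  rw [ldim, Submodule.mkQ_map_self, finrank_bot]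

/-- `Λ` is finitely generated over itself. [folklore] -/
theorem isFG_self (Λ : Submodule k V) : IsFG Λ Λ := by
  rw [IsFG, Submodule.mkQ_map_self]; exact Submodule.fg_bot

/-- The image of `Λ'` in `V ⧸ Λ` vanishes iff `Λ' ≤ Λ`. [folklore] -/
theorem map_mkQ_eq_bot_iff : Λ'.map Λ.mkQ = ⊥ ↔ Λ' ≤ Λ := by
  rw [← LinearMap.le_ker_iff_map, Submodule.ker_mkQ]

/-- Subspaces of the base are finitely generated over it. [folklore] -/
theorem isFG_of_le (h : Λ' ≤ Λ) : IsFG Λ Λ' := by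
  rw [IsFG, map_mkQ_eq_bot_iff.2 h]; exact Submodule.fg_bot

/-- Subspaces of the base have relative dimension `0`. [folklore] -/
theorem ldim_eq_zero_of_le (h : Λ' ≤ Λ) : ldim Λ Λ' = 0 := by
  rw [ldim, map_mkQ_eq_bot_iff.2 h, finrank_bot]

/-- **Vanishing** of relative dimension (for finitely generated extensions). [folklore] -/
theorem ldim_eq_zero_iff (hfg : IsFG Λ Λ') : ldim Λ Λ' = 0 ↔ Λ' ≤ Λ := by
  haveI := hfg.finite
  rw [ldim, Submodule.finrank_eq_zero, map_mkQ_eq_bot_iff]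

/-- Positivity of relative dimension. [folklore] -/
theorem ldim_pos_iff (hfg : IsFG Λ Λ') : 0 < ldim Λ Λ' ↔ ¬ Λ' ≤ Λ := by
  rw [pos_iff_ne_zero, Ne, ldim_eq_zero_iff hfg]

/-- Finitely generated by a finite set: `Λ ⊆ Λ + span s`. [folklore] -/
theorem isFG_span_finset (Λ : Submodule k V) (s : Finset V) :
    IsFG Λ (Submodule.span k (s : Set V)) := by
  rw [IsFG, Submodule.map_span]
  exact Submodule.fg_span ((s.finite_toSet).image _)

/-- Finitely generated by a finite set. [folklore] -/
theorem isFG_span_of_finite (Λ : Submodule k V) {s : Set V} (hs : s.Finite) :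
    IsFG Λ (Submodule.span k s) := by
  rw [IsFG, Submodule.map_span]
  exact Submodule.fg_span (hs.image _)

/-- `ldim(span s/Λ) ≤ |s|`. [folklore] -/
theorem ldim_span_le_card (Λ : Submodule k V) (s : Finset V) :
    ldim Λ (Submodule.span k (s : Set V)) ≤ s.card := by
  classical
  rw [ldim, Submodule.map_span]
  refine (finrank_span_le_card _).trans ?_
  rw [Set.toFinset_image, Finset.toFinset_coe]
  exact Finset.card_image_le

/-- `ldim(ℚx/Λ) ≤ 1`. [folklore] -/
theorem ldim_span_singleton_le (Λ : Submodule k V) (x : V) :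
    ldim Λ (Submodule.span k {x}) ≤ 1 := by
  simpa using ldim_span_le_card Λ {x}

/-- `ldim(ℚx/Λ) = 1` for `x ∉ Λ`. [folklore] -/
theorem ldim_span_singleton_of_not_mem {x : V} (hx : x ∉ Λ) :
    ldim Λ (Submodule.span k {x}) = 1 := by
  refine le_antisymm (ldim_span_singleton_le Λ x) ?_
  rw [Nat.one_le_iff_ne_zero, Ne, ldim_eq_zero_iff (isFG_span_of_finite Λ (finite_singleton x)),
    Submodule.span_singleton_le_iff_mem]
  exact hx

/-- `IsFG` is monotone (downwards) in the extension. [folklore] -/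
theorem IsFG.mono (h : IsFG Λ Λ'') (hle : Λ' ≤ Λ'') : IsFG Λ Λ' := by
  haveI := h.finite
  haveI : IsNoetherian k ↥(Λ''.map Λ.mkQ) := inferInstance
  exact Submodule.FG.of_le_of_isNoetherian (Submodule.map_mono hle)

/-- Relative dimension is monotone in the extension (when finite). [folklore] -/
theorem ldim_mono (h : IsFG Λ Λ'') (hle : Λ' ≤ Λ'') : ldim Λ Λ' ≤ ldim Λ Λ'' := by
  haveI := h.finite
  exact Submodule.finrank_mono (Submodule.map_mono hle)

/-- `IsFG Λ Λ'` iff `Λ' ≤ Λ ⊔ span s` for a finite `s` (which may be taken inside `Λ'`). [folklore] -/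
theorem isFG_iff_exists_finset : IsFG Λ Λ' ↔ ∃ s : Finset V, ↑s ⊆ (Λ' : Set V) ∧
    Λ' ≤ Λ ⊔ Submodule.span k (s : Set V) := by
  classical
  constructor
  · rintro ⟨t, ht⟩
    -- lift the finite generating set of the image back to `Λ'`
    have hmem : ∀ y ∈ t, ∃ x ∈ Λ', Λ.mkQ x = y := by
      intro y hy
      have : y ∈ Λ'.map Λ.mkQ := by rw [← ht]; exact Submodule.subset_span hy
      exact Submodule.mem_map.1 this
    choose! g hg using hmem
    refine ⟨t.image g, ?_, ?_⟩
    · intro x hx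
      obtain ⟨y, hy, rfl⟩ := Finset.mem_image.1 (Finset.mem_coe.1 hx)
      exact (hg y hy).1
    · intro x hx
      have hx' : Λ.mkQ x ∈ Submodule.span k (t : Set (V ⧸ Λ)) := by
        rw [ht]; exact Submodule.mem_map_of_mem hx
      have himg : (t : Set (V ⧸ Λ)) ⊆ Λ.mkQ '' (↑(t.image g) : Set V) := by
        intro y hy
        refine ⟨g y, ?_, (hg y hy).2⟩
        exact Finset.mem_coe.2 (Finset.mem_image_of_mem g hy)
      have : Λ.mkQ x ∈ (Submodule.span k (↑(t.image g) : Set V)).map Λ.mkQ := by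
        rw [Submodule.map_span]
        exact Submodule.span_mono himg hx'
      obtain ⟨z, hz, hzx⟩ := Submodule.mem_map.1 this
      have hxz : x - z ∈ Λ := by
        rw [← Submodule.Quotient.eq, ← Submodule.mkQ_apply, ← Submodule.mkQ_apply, hzx]
      have : x = (x - z) + z := by abel
      rw [this]
      exact Submodule.add_mem_sup hxz hz
  · rintro ⟨s, -, hle⟩
    exact (isFG_sup_left.2 (isFG_span_finset Λ s)).mono hle

/-- Sums of finitely generated extensions are finitely generated. [folklore] -/
theorem IsFG.sup (h : IsFG Λ Λ') (h' : IsFG Λ Λ'') : IsFG Λ (Λ' ⊔ Λ'') := by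
  rw [IsFG, Submodule.map_sup]; exact Submodule.FG.sup h h'

/-- Transitivity of finite generation along `Λ ≤ Λ'`. [folklore] -/
theorem IsFG.trans (h : IsFG Λ Λ') (h' : IsFG Λ' Λ'') : IsFG Λ Λ'' := by
  obtain ⟨s, -, hs⟩ := isFG_iff_exists_finset.1 h
  obtain ⟨t, -, ht⟩ := isFG_iff_exists_finset.1 h'
  refine ((isFG_sup_left.2 ((isFG_span_finset Λ s).sup (isFG_span_finset Λ t))).mono ?_)
  calc Λ'' ≤ Λ' ⊔ Submodule.span k ↑t := ht
    _ ≤ (Λ ⊔ Submodule.span k ↑s) ⊔ Submodule.span k ↑t := sup_le_sup_right hs _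
    _ = Λ ⊔ (Submodule.span k ↑s ⊔ Submodule.span k ↑t) := sup_assoc _ _ _

/-- Enlarging the base preserves finite generation. [folklore] -/
theorem IsFG.of_le_left (h : IsFG Λ Λ'') (hle : Λ ≤ Λ') : IsFG Λ' Λ'' := by
  obtain ⟨s, -, hs⟩ := isFG_iff_exists_finset.1 h
  exact (isFG_sup_left.2 (isFG_span_finset Λ' s)).mono (hs.trans (sup_le_sup_right hle _))


/-- **Modularity of linear dimension**: `ldim(X + Y / Y) = ldim(X / X ∩ Y)`; here in the form
`ldim Y X = ldim (X ⊓ Y) X` (both are `dim X/(X ∩ Y)`). [folklore] -/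
theorem ldim_eq_ldim_inf (X Y : Submodule k V) : ldim Y X = ldim (X ⊓ Y) X := by
  -- both images of `X` are quotients of `X` by `X ∩ Y`
  let f : ↥X →ₗ[k] V ⧸ Y := Y.mkQ ∘ₗ X.subtype
  let g : ↥X →ₗ[k] V ⧸ (X ⊓ Y) := (X ⊓ Y).mkQ ∘ₗ X.subtype
  have hf : LinearMap.range f = X.map Y.mkQ := by
    rw [LinearMap.range_comp, Submodule.range_subtype]
  have hg : LinearMap.range g = X.map (X ⊓ Y).mkQ := by
    rw [LinearMap.range_comp, Submodule.range_subtype]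
  have hker : LinearMap.ker f = LinearMap.ker g := by
    simp only [f, g, LinearMap.ker_comp, Submodule.ker_mkQ, Submodule.comap_inf,
      Submodule.comap_subtype_self, top_inf_eq]
  have e : ↥(X.map Y.mkQ) ≃ₗ[k] ↥(X.map (X ⊓ Y).mkQ) :=
    ((LinearEquiv.ofEq _ _ hf).symm.trans ((f.quotKerEquivRange.symm.trans
      (Submodule.quotEquivOfEq _ _ hker)).trans g.quotKerEquivRange)).trans
      (LinearEquiv.ofEq _ _ hg)
  exact e.finrank_eq

/-- Modularity for finite generation: `X` is finitely generated over `Y` iff over `X ⊓ Y`.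
[folklore] -/
theorem isFG_iff_isFG_inf (X Y : Submodule k V) : IsFG Y X ↔ IsFG (X ⊓ Y) X := by
  let f : ↥X →ₗ[k] V ⧸ Y := Y.mkQ ∘ₗ X.subtype
  let g : ↥X →ₗ[k] V ⧸ (X ⊓ Y) := (X ⊓ Y).mkQ ∘ₗ X.subtype
  have hf : LinearMap.range f = X.map Y.mkQ := by
    rw [LinearMap.range_comp, Submodule.range_subtype]
  have hg : LinearMap.range g = X.map (X ⊓ Y).mkQ := by
    rw [LinearMap.range_comp, Submodule.range_subtype]
  have hker : LinearMap.ker f = LinearMap.ker g := by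
    simp only [f, g, LinearMap.ker_comp, Submodule.ker_mkQ, Submodule.comap_inf,
      Submodule.comap_subtype_self, top_inf_eq]
  have e : ↥(X.map Y.mkQ) ≃ₗ[k] ↥(X.map (X ⊓ Y).mkQ) :=
    ((LinearEquiv.ofEq _ _ hf).symm.trans ((f.quotKerEquivRange.symm.trans
      (Submodule.quotEquivOfEq _ _ hker)).trans g.quotKerEquivRange)).trans
      (LinearEquiv.ofEq _ _ hg)
  rw [isFG_iff_finite, isFG_iff_finite]
  exact ⟨fun h => Module.Finite.equiv e, fun h => Module.Finite.equiv e.symm⟩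

/-- **Addition formula for linear dimension** along `Λ ≤ Λ' ≤ Λ''` (for a finitely generated
extension). [folklore] -/
theorem ldim_add (h₁ : Λ ≤ Λ') (h₂ : Λ' ≤ Λ'') (hfg : IsFG Λ Λ'') :
    ldim Λ Λ'' = ldim Λ Λ' + ldim Λ' Λ'' := by
  haveI := hfg.finite
  -- `W = Λ''/Λ ⊇ N = Λ'/Λ`, and `W/N ≅ Λ''/Λ'`
  set W : Submodule k (V ⧸ Λ) := Λ''.map Λ.mkQ with hW
  let N : Submodule k ↥W := (Λ'.map Λ.mkQ).comap W.subtype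
  have hNW : Λ'.map Λ.mkQ ≤ W := Submodule.map_mono h₂
  have hN : Module.finrank k ↥N = ldim Λ Λ' := by
    rw [ldim]
    exact (Submodule.comapSubtypeEquivOfLe hNW).finrank_eq
  -- the map `W → V/Λ'` induced by `V/Λ → V/Λ'`
  let π : (V ⧸ Λ) →ₗ[k] V ⧸ Λ' := Submodule.mapQ Λ Λ' LinearMap.id h₁
  let φ : ↥W →ₗ[k] V ⧸ Λ' := π ∘ₗ W.subtype
  have hrange : LinearMap.range φ = Λ''.map Λ'.mkQ := by
    rw [LinearMap.range_comp, Submodule.range_subtype, hW, ← Submodule.map_comp]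
    congr 1
  have hkerφ : LinearMap.ker φ = N := by
    ext ⟨w, hw⟩
    obtain ⟨v, hv, rfl⟩ := Submodule.mem_map.1 hw
    simp only [φ, N, LinearMap.mem_ker, LinearMap.comp_apply, Submodule.subtype_apply,
      Submodule.mem_comap]
    change π (Submodule.Quotient.mk v) = 0 ↔ Λ.mkQ v ∈ Λ'.map Λ.mkQ
    rw [Submodule.mapQ_apply, LinearMap.id_apply, Submodule.Quotient.mk_eq_zero]
    constructor
    · intro hv'
      exact Submodule.mem_map_of_mem hv'
    · intro hv'
      obtain ⟨u, hu, huv⟩ := Submodule.mem_map.1 hv'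
      have : v - u ∈ Λ := by
        rw [← Submodule.Quotient.eq, ← Submodule.mkQ_apply, ← Submodule.mkQ_apply, huv]
      have hvu : v = (v - u) + u := by abel
      rw [hvu]
      exact Λ'.add_mem (h₁ this) hu
  have hquot : Module.finrank k (↥W ⧸ N) = ldim Λ' Λ'' := by
    rw [ldim, ← hrange, ← hkerφ]
    exact φ.quotKerEquivRange.finrank_eq
  have := Submodule.finrank_quotient_add_finrank N
  rw [hquot, hN] at this
  rw [ldim, ← hW]
  omega

end LinearDimension

section Acl

variable {F : Type*} [Field F] [CharZero F] {x y a : F} {s : Set F}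

/-! ### Relative algebraic closure (the algebraic matroid of `F` over `ℚ`) -/

variable (F) in
/-- The algebraic matroid of `F` over `ℚ` (independent sets = algebraically independent sets;
Mathlib's `AlgebraicIndependent.matroid`). [folklore] -/
abbrev algMatroid : Matroid F :=
  AlgebraicIndependent.matroid ℚ F

/-- The relative algebraic closure `acl s = {a ∈ F | a algebraic over ℚ(s)}` of a subset of `F`,
i.e. the closure operator of the algebraic matroid. [folklore] -/
def acl (s : Set F) : Set F :=
  (algMatroid F).closure s

/-- Membership in `acl`: algebraicity over the subring `ℚ[s]`. [folklore] -/
theorem mem_acl_iff : a ∈ acl s ↔ IsAlgebraic (Algebra.adjoin ℚ s) a := by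
  rw [acl, AlgebraicIndependent.matroid_closure_eq]
  rfl

/-- `s ⊆ acl s`. [folklore] -/
theorem subset_acl (s : Set F) : s ⊆ acl s :=
  (algMatroid F).subset_closure s

/-- `acl` is monotone. [folklore] -/
theorem acl_mono {s t : Set F} (h : s ⊆ t) : acl s ⊆ acl t :=
  (algMatroid F).closure_subset_closure h

/-- `acl` is idempotent. [folklore] -/
@[simp] theorem acl_acl (s : Set F) : acl (acl s) = acl s :=
  (algMatroid F).closure_closure s

/-- `acl s ⊆ acl t` as soon as `s ⊆ acl t`. [folklore] -/
theorem acl_subset_acl_of_subset {s t : Set F} (h : s ⊆ acl t) : acl s ⊆ acl t :=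
  (algMatroid F).closure_subset_closure_of_subset_closure h

/-- `acl s` is (the carrier of) a `ℚ`-subalgebra of `F` closed under taking elements algebraic
over it (flats of the algebraic matroid). [folklore] -/
theorem exists_subalgebra_eq_acl (s : Set F) :
    ∃ S : Subalgebra ℚ F, (S : Set F) = acl s ∧ ∀ a : F, IsAlgebraic S a → a ∈ acl s :=
  AlgebraicIndependent.matroid_isFlat_iff.1 ((algMatroid F).isFlat_closure (X := s))

/-- `acl s` is closed under addition. [folklore] -/
theorem add_mem_acl (hx : x ∈ acl s) (hy : y ∈ acl s) : x + y ∈ acl s := by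
  obtain ⟨S, hS, -⟩ := exists_subalgebra_eq_acl s
  rw [← hS] at hx hy ⊢
  exact S.add_mem hx hy

/-- `acl s` is closed under multiplication. [folklore] -/
theorem mul_mem_acl (hx : x ∈ acl s) (hy : y ∈ acl s) : x * y ∈ acl s := by
  obtain ⟨S, hS, -⟩ := exists_subalgebra_eq_acl s
  rw [← hS] at hx hy ⊢
  exact S.mul_mem hx hy

/-- `acl s` is closed under negation. [folklore] -/
theorem neg_mem_acl (hx : x ∈ acl s) : -x ∈ acl s := by
  obtain ⟨S, hS, -⟩ := exists_subalgebra_eq_acl s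
  rw [← hS] at hx ⊢
  exact S.neg_mem hx

/-- `acl s` contains the rationals. [folklore] -/
theorem algebraMap_mem_acl (q : ℚ) : algebraMap ℚ F q ∈ acl s := by
  obtain ⟨S, hS, -⟩ := exists_subalgebra_eq_acl s
  rw [← hS]
  exact S.algebraMap_mem q

/-- `0 ∈ acl s`. [folklore] -/
theorem zero_mem_acl (s : Set F) : (0 : F) ∈ acl s := by
  simpa using algebraMap_mem_acl (s := s) 0

/-- `1 ∈ acl s`. [folklore] -/
theorem one_mem_acl (s : Set F) : (1 : F) ∈ acl s := by
  simpa using algebraMap_mem_acl (s := s) 1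

/-- `acl s` is closed under `ℚ`-scalar multiplication. [folklore] -/
theorem smul_mem_acl (q : ℚ) (hx : x ∈ acl s) : q • x ∈ acl s := by
  rw [Algebra.smul_def]
  exact mul_mem_acl (algebraMap_mem_acl q) hx

/-- Elements algebraic over `acl s` (e.g. roots of polynomials with coefficients in `acl s`)
lie in `acl s`: if `a ^ n ∈ acl s` for some `n ≥ 1` then `a ∈ acl s`. [folklore] -/
theorem mem_acl_of_pow_mem {n : ℕ} (hn : n ≠ 0) (ha : a ^ n ∈ acl s) : a ∈ acl s := by
  obtain ⟨S, hS, halg⟩ := exists_subalgebra_eq_acl s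
  rw [← hS] at ha
  refine halg a ⟨Polynomial.X ^ n - Polynomial.C ⟨a ^ n, ha⟩, ?_, ?_⟩
  · intro h
    have := congr_arg Polynomial.natDegree h
    rw [Polynomial.natDegree_X_pow_sub_C, Polynomial.natDegree_zero] at this
    exact hn this
  · simp

/-- `acl s` is closed under inversion. [folklore] -/
theorem inv_mem_acl (hx : x ∈ acl s) : x⁻¹ ∈ acl s := by
  rcases eq_or_ne x 0 with rfl | hx0
  · rwa [inv_zero]
  obtain ⟨S, hS, halg⟩ := exists_subalgebra_eq_acl s
  rw [← hS] at hx
  refine halg _ ⟨Polynomial.C ⟨x, hx⟩ * Polynomial.X - 1, ?_, ?_⟩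
  · intro h
    have := congr_arg (Polynomial.eval 0) (congr_arg (Polynomial.map (algebraMap S F)) h)
    simp at this
  · simp [hx0]

/-- `acl s` is closed under integer powers. [folklore] -/
theorem zpow_mem_acl (hx : x ∈ acl s) (n : ℤ) : x ^ n ∈ acl s := by
  obtain ⟨S, hS, -⟩ := exists_subalgebra_eq_acl s
  cases n with
  | ofNat n =>
    rw [Int.ofNat_eq_natCast, zpow_natCast, ← hS]
    rw [← hS] at hx
    exact S.pow_mem hx n
  | negSucc n =>
    rw [zpow_negSucc]
    refine inv_mem_acl ?_
    rw [← hS] at hx ⊢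
    exact S.pow_mem hx _

/-- The subfield generated by `s` is contained in `acl s`. [folklore] -/
theorem subfieldClosure_subset_acl (s : Set F) : (Subfield.closure s : Set F) ⊆ acl s := by
  let K : Subfield F :=
    { carrier := acl s
      mul_mem' := mul_mem_acl
      one_mem' := one_mem_acl s
      add_mem' := add_mem_acl
      zero_mem' := zero_mem_acl s
      neg_mem' := neg_mem_acl
      inv_mem' := fun _ => inv_mem_acl }
  change (Subfield.closure s : Set F) ⊆ (K : Set F)
  exact Subfield.closure_le.2 (subset_acl s)

/-- The field `ℚ(s)` is contained in `acl s`. [folklore] -/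
theorem adjoin_subset_acl (s : Set F) : (IntermediateField.adjoin ℚ s : Set F) ⊆ acl s := by
  intro a ha
  have ha' : a ∈ (IntermediateField.adjoin ℚ s).toSubfield := ha
  rw [IntermediateField.adjoin_toSubfield] at ha'
  have h : a ∈ acl (Set.range (algebraMap ℚ F) ∪ s) := subfieldClosure_subset_acl _ ha'
  refine acl_subset_acl_of_subset ?_ h
  rintro b (⟨q, rfl⟩ | hb)
  · exact algebraMap_mem_acl q
  · exact subset_acl s hb

end Acl

variable {F : Type*} [Field F] [CharZero F] [Literature.ModelTheory.ExponentialFields.ExponentialRing F]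

/-! ### The Γ-subfield attached to a `ℚ`-subspace -/

/-- The coordinates of the points of `Γ(A) = {(x, eˣ) : x ∈ Λ}`: the set `Λ ∪ exp(Λ)`
(Bays–Kirby 2018, Def. 3.8: a Γ-field "is generated as a field by `Γ(A)`").
[cite: BaysKirby2018ANT, Def. 3.8] -/
def gens (Λ : Submodule ℚ F) : Set F :=
  (Λ : Set F) ∪ exp '' (Λ : Set F)

/-- The **Γ-subfield** of `F` attached to `Λ`: the subfield `ℚ(Λ, exp Λ)` generated by the
coordinates of `Γ(A)` (Bays–Kirby 2018, Def. 3.8 and Remark 3.11(4), exponential case inside `F`;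
`k₀ = ℚ`). [cite: BaysKirby2018ANT, Def. 3.8] -/
def fieldOf (Λ : Submodule ℚ F) : IntermediateField ℚ F :=
  IntermediateField.adjoin ℚ (gens Λ)

variable {Λ Λ' Λ'' : Submodule ℚ F} {x y a : F} {s : Set F}

/-- `Λ ⊆ gens Λ`. [folklore] -/
theorem subset_gens (Λ : Submodule ℚ F) : (Λ : Set F) ⊆ gens Λ :=
  subset_union_left

/-- Elements of `Λ` are generators. [folklore] -/
theorem mem_gens_of_mem (hx : x ∈ Λ) : x ∈ gens Λ :=
  Or.inl hx

/-- Exponentials of elements of `Λ` are generators. [folklore] -/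
theorem exp_mem_gens (hx : x ∈ Λ) : exp x ∈ gens Λ :=
  Or.inr ⟨x, hx, rfl⟩

/-- Membership in `gens`. [folklore] -/
theorem mem_gens_iff : a ∈ gens Λ ↔ a ∈ Λ ∨ ∃ x ∈ Λ, exp x = a :=
  Iff.rfl

/-- `gens` is monotone. [folklore] -/
theorem gens_mono (h : Λ ≤ Λ') : gens Λ ⊆ gens Λ' :=
  union_subset_union (fun _ hx => h hx) (image_mono fun _ hx => h hx)

/-- `gens (Λ ⊔ Λ') ⊇ gens Λ ∪ gens Λ'`. [folklore] -/
theorem gens_union_subset_gens_sup : gens Λ ∪ gens Λ' ⊆ gens (Λ ⊔ Λ') :=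
  union_subset (gens_mono le_sup_left) (gens_mono le_sup_right)

/-- The generators lie in the Γ-subfield. [folklore] -/
theorem gens_subset_fieldOf (Λ : Submodule ℚ F) : gens Λ ⊆ fieldOf Λ :=
  IntermediateField.subset_adjoin _ _

/-- `Λ ⊆ A`. [folklore] -/
theorem mem_fieldOf_of_mem (hx : x ∈ Λ) : x ∈ fieldOf Λ :=
  gens_subset_fieldOf Λ (mem_gens_of_mem hx)

/-- `exp Λ ⊆ A`. [folklore] -/
theorem exp_mem_fieldOf (hx : x ∈ Λ) : exp x ∈ fieldOf Λ :=
  gens_subset_fieldOf Λ (exp_mem_gens hx)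

/-- `fieldOf` is monotone. [folklore] -/
theorem fieldOf_mono (h : Λ ≤ Λ') : fieldOf Λ ≤ fieldOf Λ' :=
  IntermediateField.adjoin.mono _ _ _ (gens_mono h)

/-- The Γ-subfield `A = ℚ(Λ, exp Λ)` is contained in `acl (gens Λ)`. [folklore] -/
theorem fieldOf_subset_acl (Λ : Submodule ℚ F) : (fieldOf Λ : Set F) ⊆ acl (gens Λ) :=
  adjoin_subset_acl _

/-- `acl (fieldOf Λ) = acl (gens Λ)`. [folklore] -/
theorem acl_fieldOf (Λ : Submodule ℚ F) : acl (fieldOf Λ : Set F) = acl (gens Λ) :=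
  Subset.antisymm (acl_subset_acl_of_subset (fieldOf_subset_acl Λ))
    (acl_mono (gens_subset_fieldOf Λ))

/-- If `exp x ∈ acl s` then `exp (q • x) ∈ acl s` for every rational `q` (it is a root of
`Y ^ den q - (exp x) ^ num q`). [folklore] -/
theorem exp_smul_mem_acl (q : ℚ) (hx : exp x ∈ acl s) : exp (q • x) ∈ acl s := by
  refine mem_acl_of_pow_mem q.den_nz ?_
  rw [← exp_nsmul, ← Nat.cast_smul_eq_nsmul ℚ, smul_smul, Rat.den_mul_eq_num, Int.cast_smul_eq_zsmul,
    exp_zsmul]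
  exact zpow_mem_acl hx _

/-- The generators of `Λ ⊔ span s` are algebraic over `gens Λ ∪ s ∪ exp s`. [folklore] -/
theorem gens_sup_span_subset_acl (Λ : Submodule ℚ F) (s : Set F) :
    gens (Λ ⊔ Submodule.span ℚ s) ⊆ acl (gens Λ ∪ (s ∪ exp '' s)) := by
  set T := gens Λ ∪ (s ∪ exp '' s) with hT
  have key : ∀ z ∈ Submodule.span ℚ s, z ∈ acl T ∧ exp z ∈ acl T := by
    intro z hz
    induction hz using Submodule.span_induction with
    | mem u hu => exact ⟨subset_acl T (Or.inr (Or.inl hu)), subset_acl T (Or.inr (Or.inr ⟨u, hu, rfl⟩))⟩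
    | zero => exact ⟨zero_mem_acl T, by rw [Literature.ModelTheory.ExponentialFields.ExponentialRing.exp_zero]; exact one_mem_acl T⟩
    | add u v _ _ hu hv =>
      exact ⟨add_mem_acl hu.1 hv.1, by rw [exp_add]; exact mul_mem_acl hu.2 hv.2⟩
    | smul q u _ hu => exact ⟨smul_mem_acl q hu.1, exp_smul_mem_acl q hu.2⟩
  have hΛ : ∀ z ∈ Λ, z ∈ acl T ∧ exp z ∈ acl T := fun z hz =>
    ⟨subset_acl T (Or.inl (mem_gens_of_mem hz)), subset_acl T (Or.inl (exp_mem_gens hz))⟩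
  rintro b (hb | ⟨z, hz, rfl⟩)
  · obtain ⟨u, hu, v, hv, rfl⟩ := Submodule.mem_sup.1 hb
    exact add_mem_acl (hΛ u hu).1 (key v hv).1
  · obtain ⟨u, hu, v, hv, rfl⟩ := Submodule.mem_sup.1 (show z ∈ Λ ⊔ Submodule.span ℚ s from hz)
    rw [exp_add]
    exact mul_mem_acl (hΛ u hu).2 (key v hv).2

/-- The generators of `Λ ⊔ Λ'` are algebraic over `gens Λ ∪ gens Λ'`. [folklore] -/
theorem gens_sup_subset_acl (Λ Λ' : Submodule ℚ F) : gens (Λ ⊔ Λ') ⊆ acl (gens Λ ∪ gens Λ') := by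
  have h := gens_sup_span_subset_acl Λ (Λ' : Set F)
  rw [Submodule.span_eq] at h
  refine h.trans (acl_subset_acl_of_subset ?_)
  rintro b (hb | hb | ⟨z, hz, rfl⟩)
  · exact subset_acl _ (Or.inl hb)
  · exact subset_acl _ (Or.inr (mem_gens_of_mem hb))
  · exact subset_acl _ (Or.inr (exp_mem_gens hz))

/-- `acl (gens (Λ ⊔ Λ')) = acl (gens Λ ∪ gens Λ')`. [folklore] -/
theorem acl_gens_sup (Λ Λ' : Submodule ℚ F) : acl (gens (Λ ⊔ Λ')) = acl (gens Λ ∪ gens Λ') :=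
  Subset.antisymm (acl_subset_acl_of_subset (gens_sup_subset_acl Λ Λ'))
    (acl_mono gens_union_subset_gens_sup)

/-! ### Relative transcendence degree and the predimension (Bays–Kirby Def. 4.1) -/

section Predimension

/-- `td(A'/A)`: the transcendence degree of the compositum `A A'` over the Γ-subfield
`A = ℚ(Λ, exp Λ)`, computed as the relative rank of the generators `gens Λ'` over `gens Λ` in the
algebraic matroid of `F` over `ℚ` (rank in the contraction by `gens Λ`; a transcendence basis of
`A(gens Λ')/A` chosen inside `gens Λ'` is exactly a basis of `gens Λ'` in that contraction). An
`ℕ∞`, finite for finitely generated extensions (`td_lt_top`). Bays–Kirby 2018, Def. 4.1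
(`td(X/A)`), exponential case inside `F`. [cite: BaysKirby2018ANT, Def. 4.1] -/
def td (Λ Λ' : Submodule ℚ F) : ℕ∞ :=
  (algMatroid F).relRank (gens Λ) (gens Λ')

/-- Unfolding lemma for `td`. [folklore] -/
theorem td_def (Λ Λ' : Submodule ℚ F) : td Λ Λ' = (algMatroid F).relRank (gens Λ) (gens Λ') :=
  rfl

/-- `td` only depends on the algebraic closure of the generators: `td Λ Λ' = relRank (gens Λ) S`
whenever `acl (S ∪ gens Λ) = acl (gens Λ' ∪ gens Λ)`. [folklore] -/
theorem td_eq_relRank_of_acl_eq {S : Set F} (h : acl (gens Λ' ∪ gens Λ) = acl (S ∪ gens Λ)) :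
    td Λ Λ' = (algMatroid F).relRank (gens Λ) S :=
  (algMatroid F).relRank_congr_closure (gens Λ) h

/-- `td(Λ + Λ'/Λ) = td(Λ'/Λ)`. [folklore] -/
@[simp] theorem td_sup_left (Λ Λ' : Submodule ℚ F) : td Λ (Λ ⊔ Λ') = td Λ Λ' := by
  refine (algMatroid F).relRank_congr_closure (gens Λ) ?_
  change acl (gens (Λ ⊔ Λ') ∪ gens Λ) = acl (gens Λ' ∪ gens Λ)
  refine Subset.antisymm (acl_subset_acl_of_subset ?_) (acl_mono ?_)
  · rintro b (hb | hb)
    · refine acl_mono ?_ (gens_sup_subset_acl Λ Λ' hb)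
      rintro c (hc | hc)
      · exact Or.inr hc
      · exact Or.inl hc
    · exact subset_acl _ (Or.inr hb)
  · exact union_subset_union_left _ (gens_mono le_sup_right)

/-- `td(Λ' + Λ/Λ) = td(Λ'/Λ)`. [folklore] -/
@[simp] theorem td_sup_right (Λ Λ' : Submodule ℚ F) : td Λ (Λ' ⊔ Λ) = td Λ Λ' := by
  rw [sup_comm, td_sup_left]

/-- `td(Λ/Λ) = 0`. [folklore] -/
@[simp] theorem td_self (Λ : Submodule ℚ F) : td Λ Λ = 0 :=
  (algMatroid F).relRank_self _

/-- `td` vanishes on subspaces of the base. [folklore] -/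
theorem td_eq_zero_of_le (h : Λ' ≤ Λ) : td Λ Λ' = 0 :=
  (algMatroid F).relRank_eq_zero_of_subset_closure ((gens_mono h).trans (subset_acl _))

/-- `td` is monotone in the extension. [folklore] -/
theorem td_mono (Λ : Submodule ℚ F) (h : Λ' ≤ Λ'') : td Λ Λ' ≤ td Λ Λ'' :=
  (algMatroid F).relRank_mono_right _ (gens_mono h)

/-- `td` is anti-monotone in the base (base change can only lower transcendence degrees).
[folklore] -/
theorem td_anti (Λ'' : Submodule ℚ F) (h : Λ ≤ Λ') : td Λ' Λ'' ≤ td Λ Λ'' :=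
  (algMatroid F).relRank_anti_left _ (gens_mono h)

/-- The generators of `span s` over `Λ` have relative rank at most that of `s ∪ exp s`.
[folklore] -/
theorem td_span_le_relRank (Λ : Submodule ℚ F) (s : Set F) :
    td Λ (Submodule.span ℚ s) ≤ (algMatroid F).relRank (gens Λ) (s ∪ exp '' s) := by
  rw [← td_sup_left]
  refine (algMatroid F).relRank_le_of_subset_closure (gens Λ) ?_
  refine (gens_sup_span_subset_acl Λ s).trans (acl_mono ?_)
  rintro b (hb | hb)
  · exact Or.inr hb
  · exact Or.inl hb

/-- `td(Λ + span s / Λ) ≤ 2 |s|`: the extension is generated, up to algebraic elements, by the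
elements of `s` and their exponentials. [folklore] -/
theorem td_span_le (Λ : Submodule ℚ F) (s : Finset F) :
    td Λ (Submodule.span ℚ (s : Set F)) ≤ 2 * s.card := by
  classical
  refine (td_span_le_relRank Λ (s : Set F)).trans ?_
  refine ((algMatroid F).relRank_le_encard_diff _ _).trans ?_
  refine (encard_le_encard sdiff_subset).trans ?_
  refine (encard_union_le _ _).trans ?_
  have himg : exp '' (s : Set F) = ((s.image exp : Finset F) : Set F) := by simp
  rw [two_mul, himg, encard_coe_eq_coe_finsetCard, encard_coe_eq_coe_finsetCard]
  exact_mod_cast Nat.add_le_add_left Finset.card_image_le _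

/-- Finitely generated extensions have finite `td`. [folklore] -/
theorem td_lt_top (h : IsFG Λ Λ') : td Λ Λ' < ⊤ := by
  obtain ⟨s, -, hs⟩ := isFG_iff_exists_finset.1 h
  calc td Λ Λ' ≤ td Λ (Λ ⊔ Submodule.span ℚ (s : Set F)) := td_mono Λ hs
    _ = td Λ (Submodule.span ℚ (s : Set F)) := td_sup_left _ _
    _ ≤ 2 * s.card := td_span_le Λ s
    _ < ⊤ := by
      rw [lt_top_iff_ne_top]
      exact_mod_cast ENat.coe_ne_top (2 * s.card)

/-- Finitely generated extensions have finite `td` (the `≠ ⊤` form). [folklore] -/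
theorem td_ne_top (h : IsFG Λ Λ') : td Λ Λ' ≠ ⊤ :=
  (td_lt_top h).ne

/-- **Addition formula for `td`** along `Λ ≤ Λ' ≤ Λ''` (tower law for transcendence degrees).
[cite: BaysKirby2018ANT, Lemma 4.2 (2)] -/
theorem td_add (h₁ : Λ ≤ Λ') (h₂ : Λ' ≤ Λ'') : td Λ Λ'' = td Λ Λ' + td Λ' Λ'' :=
  ((algMatroid F).relRank_add_relRank (gens_mono h₁) (gens_mono h₂)).symm

/-- **Submodularity of `td`**: `td(X + Y / Y) ≤ td(X / X ∩ Y)`. [cite: BaysKirby2018ANT, Lemma 4.2 (3)] -/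
theorem td_sup_le_td_inf (X Y : Submodule ℚ F) : td Y (X ⊔ Y) ≤ td (X ⊓ Y) X := by
  rw [td_sup_right]
  exact td_anti X inf_le_right

/-- The **predimension** `δ(A'/A) = td(A'/A) - ldim_ℚ(Γ(A')/Γ(A))` of Bays–Kirby 2018, Def. 4.1,
in the exponential case (`d = 1`, `k_𝒪 = ℚ`) inside `F`, for the Γ-subfields attached to
`Λ ≤ Λ + Λ'`: an integer, meaningful when the extension is finitely generated (`IsFG Λ Λ'`;
otherwise both terms take junk values). For a finite tuple `x̄` and `Λ' = span x̄` this is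
`δ(x̄/A) = td(x̄, exp x̄/A) - ldim_ℚ(x̄/Λ)` (loc. cit., "Note that `δ(b/A) = trd(b/A) -
d ldim_{k_𝒪}(b/Γ(A))`"). [cite: BaysKirby2018ANT, Def. 4.1] -/
def predim (Λ Λ' : Submodule ℚ F) : ℤ :=
  ((td Λ Λ').toNat : ℤ) - (ldim Λ Λ' : ℤ)

/-- Unfolding lemma for `predim`. [folklore] -/
theorem predim_def (Λ Λ' : Submodule ℚ F) :
    predim Λ Λ' = ((td Λ Λ').toNat : ℤ) - (ldim Λ Λ' : ℤ) :=
  rfl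

/-- `δ(Λ + Λ'/Λ) = δ(Λ'/Λ)`. [folklore] -/
@[simp] theorem predim_sup_left (Λ Λ' : Submodule ℚ F) : predim Λ (Λ ⊔ Λ') = predim Λ Λ' := by
  rw [predim, predim, td_sup_left, ldim_sup_left]

/-- `δ(Λ' + Λ/Λ) = δ(Λ'/Λ)`. [folklore] -/
@[simp] theorem predim_sup_right (Λ Λ' : Submodule ℚ F) : predim Λ (Λ' ⊔ Λ) = predim Λ Λ' := by
  rw [sup_comm, predim_sup_left]

/-- `δ(Λ/Λ) = 0`. [folklore] -/
@[simp] theorem predim_self (Λ : Submodule ℚ F) : predim Λ Λ = 0 := by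
  simp [predim]

/-- `δ` vanishes on subspaces of the base. [folklore] -/
theorem predim_eq_zero_of_le (h : Λ' ≤ Λ) : predim Λ Λ' = 0 := by
  rw [predim, td_eq_zero_of_le h, ldim_eq_zero_of_le h]; rfl

/-- **Addition formula for the predimension** (Bays–Kirby 2018, Lemma 4.2 (2)): for
`Λ ≤ Λ' ≤ Λ''` with `Λ''` finitely generated over `Λ`, `δ(Λ''/Λ) = δ(Λ''/Λ') + δ(Λ'/Λ)`.
[cite: BaysKirby2018ANT, Lemma 4.2 (2)] -/
theorem predim_add (h₁ : Λ ≤ Λ') (h₂ : Λ' ≤ Λ'') (hfg : IsFG Λ Λ'') :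
    predim Λ Λ'' = predim Λ Λ' + predim Λ' Λ'' := by
  have h1 : IsFG Λ Λ' := hfg.mono h₂
  have h2 : IsFG Λ' Λ'' := hfg.of_le_left h₁
  rw [predim, predim, predim, td_add h₁ h₂, ENat.toNat_add (td_ne_top h1) (td_ne_top h2),
    ldim_add h₁ h₂ hfg]
  push_cast
  ring

/-- **Submodularity of the predimension** (Bays–Kirby 2018, Lemma 4.2 (3)): if `X` is finitely
generated over `X ∩ Y` then `δ(X + Y / Y) ≤ δ(X / X ∩ Y)`. [cite: BaysKirby2018ANT, Lemma 4.2 (3)] -/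
theorem predim_sup_le (X Y : Submodule ℚ F) (hfg : IsFG (X ⊓ Y) X) :
    predim Y (X ⊔ Y) ≤ predim (X ⊓ Y) X := by
  rw [predim, predim, ldim_sup_right, ldim_eq_ldim_inf X Y]
  have h := td_sup_le_td_inf X Y
  have hfin : td (X ⊓ Y) X ≠ ⊤ := td_ne_top hfg
  have : (td Y (X ⊔ Y)).toNat ≤ (td (X ⊓ Y) X).toNat := ENat.toNat_le_toNat h hfin
  linarith [Int.ofNat_le.2 this]

/-- Base change over an intermediate subspace: for `Λ ≤ Λ' ` and `X` finitely generated over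
`Λ`, `δ(X + Λ'/Λ') ≤ δ(X/Λ) - δ(X ∩ Λ' … )` in the form used for hulls:
`δ(X ⊔ Λ' / Λ') ≤ δ(X / X ⊓ Λ')`. (Restatement of submodularity.) [cite: BaysKirby2018ANT, Lemma 4.2 (3)] -/
theorem predim_sup_le' (X Λ' : Submodule ℚ F) (hfg : IsFG (X ⊓ Λ') X) :
    predim Λ' (X ⊔ Λ') ≤ predim (X ⊓ Λ') X :=
  predim_sup_le X Λ' hfg

end Predimension

/-! ### Strong subspaces, Γ-closed subspaces, hulls (Bays–Kirby §4.2–4.3) -/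

section Strong

variable {D E H K X : Submodule ℚ F} {d : F}

/-- **Strong Γ-subfields** (Bays–Kirby 2018, Def. 4.3, `A ◁ F`, exponential case inside `F`):
the Γ-subfield attached to `Λ` is *strong* in `F` if every finitely generated extension of it
inside `F` has non-negative predimension, `δ(Λ'/Λ) ≥ 0`. (The kernel condition of Def. 4.3 —
extensions inside `F` preserve the kernel as soon as `ker exp ⊆ Λ` — is kept as a separate
hypothesis where needed.) [cite: BaysKirby2018ANT, Def. 4.3] -/
def IsStrong (Λ : Submodule ℚ F) : Prop :=
  ∀ ⦃Λ' : Submodule ℚ F⦄, Λ ≤ Λ' → IsFG Λ Λ' → 0 ≤ predim Λ Λ'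

/-- `Λ ◁ F` iff `δ(Λ'/Λ) ≥ 0` for *all* `Λ'` finitely generated over `Λ` (not only those
containing `Λ`). [cite: BaysKirby2018ANT, Def. 4.3] -/
theorem isStrong_iff : IsStrong Λ ↔ ∀ Λ' : Submodule ℚ F, IsFG Λ Λ' → 0 ≤ predim Λ Λ' := by
  refine ⟨fun h Λ' hfg => ?_, fun h Λ' _ hfg => h Λ' hfg⟩
  rw [← predim_sup_left]
  exact h le_sup_left (isFG_sup_left.2 hfg)

/-- `Λ ◁ F` iff `δ(x̄/Λ) ≥ 0` for every finite tuple `x̄`. [cite: BaysKirby2018ANT, Def. 4.3] -/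
theorem isStrong_iff_finset :
    IsStrong Λ ↔ ∀ s : Finset F, 0 ≤ predim Λ (Submodule.span ℚ (s : Set F)) := by
  rw [isStrong_iff]
  refine ⟨fun h s => h _ (isFG_span_finset Λ s), fun h Λ' hfg => ?_⟩
  obtain ⟨s, hs, hle⟩ := isFG_iff_exists_finset.1 hfg
  have heq : Λ ⊔ Λ' = Λ ⊔ Submodule.span ℚ (s : Set F) :=
    le_antisymm (sup_le le_sup_left hle)
      (sup_le le_sup_left ((Submodule.span_le.2 hs).trans le_sup_right))
  rw [← predim_sup_left, heq, predim_sup_left]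
  exact h s

/-- The whole field is strong in itself. [folklore] -/
theorem isStrong_top : IsStrong (⊤ : Submodule ℚ F) :=
  fun Λ' _ _ => by rw [predim_eq_zero_of_le (le_top : Λ' ≤ ⊤)]

/-- **Γ-closed Γ-subfields** (Bays–Kirby 2018, Def. 4.9, `A ◁_cl F`): `Λ` is *Γ-closed in `F`*
if it has no proper finitely generated extension inside `F` of predimension `≤ 0`.
[cite: BaysKirby2018ANT, Def. 4.9] -/
def IsGammaClosed (Λ : Submodule ℚ F) : Prop :=
  ∀ ⦃Λ' : Submodule ℚ F⦄, Λ ≤ Λ' → IsFG Λ Λ' → predim Λ Λ' ≤ 0 → Λ' = Λ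

/-- Γ-closed implies strong (Bays–Kirby 2018, Lemma 4.10 (1)). [cite: BaysKirby2018ANT, Lemma 4.10 (1)] -/
theorem IsGammaClosed.isStrong (h : IsGammaClosed Λ) : IsStrong Λ := by
  intro Λ' hle hfg
  by_contra hneg
  push Not at hneg
  have := h hle hfg hneg.le
  rw [this, predim_self] at hneg
  exact lt_irrefl _ hneg

/-- Over a Γ-closed `Λ`, proper finitely generated extensions have predimension `≥ 1`.
[cite: BaysKirby2018ANT, Def. 4.9] -/
theorem IsGammaClosed.one_le_predim (h : IsGammaClosed Λ) (hle : Λ ≤ Λ') (hfg : IsFG Λ Λ')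
    (hne : Λ' ≠ Λ) : 1 ≤ predim Λ Λ' := by
  by_contra hlt
  push Not at hlt
  exact hne (h hle hfg (by omega))

/-- **Minimal predimension gives strong extensions** (Bays–Kirby 2018, discussion before
Lemma 4.5: replacing `X` by an extension `X'` with `δ(X'/A)` minimal, "from the addition formula
for `δ` it follows that `X' ◁ B`"): if `Λ ≤ Λ'` is finitely generated and `δ(Λ'/Λ)` is minimal
among the finitely generated extensions of `Λ'`, then `Λ' ◁ F`. [cite: BaysKirby2018ANT, §4.2 (before Lemma 4.5)] -/
theorem isStrong_of_forall_predim_le (hle : Λ ≤ Λ') (hfg : IsFG Λ Λ')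
    (hmin : ∀ Λ'' : Submodule ℚ F, Λ' ≤ Λ'' → IsFG Λ Λ'' → predim Λ Λ' ≤ predim Λ Λ'') :
    IsStrong Λ' := by
  intro Λ'' hle' hfg'
  have hfg'' : IsFG Λ Λ'' := hfg.trans hfg'
  have := predim_add hle hle' hfg''
  linarith [hmin Λ'' hle' hfg'']

/-- **Bays–Kirby 2018, Lemma 4.8**: if `Λ ◁ F`, `Λ ≤ Λ'` is finitely generated and
`δ(Λ'/Λ) = 0`, then `Λ' ◁ F`. [cite: BaysKirby2018ANT, Lemma 4.8] -/
theorem IsStrong.of_predim_eq_zero (h : IsStrong Λ) (hle : Λ ≤ Λ') (hfg : IsFG Λ Λ')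
    (h0 : predim Λ Λ' = 0) : IsStrong Λ' :=
  isStrong_of_forall_predim_le hle hfg fun _ hle' hfg'' => h0 ▸ h (hle.trans hle') hfg''

/-- **Strong extensions by minimisation inside a strong `H`** (the hull construction of
Bays–Kirby 2018, Def. 4.6 / Lemma 4.5, in the form used later): if `Λ ≤ Λ' ≤ H` with `H ◁ F`,
`Λ'` finitely generated over `Λ`, and `δ(Λ'/Λ)` is minimal among the finitely generated
extensions of `Λ'` *inside `H`*, then `Λ' ◁ F`. (For `X ⊇ Λ'`: `δ(X/Λ') = δ(X/X ∩ H) +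
δ(X ∩ H/Λ')`, the first term is `≥ δ(X + H/H) ≥ 0` by submodularity and `H ◁ F`, the second is
`≥ 0` by minimality.) [cite: BaysKirby2018ANT, Lemma 4.5 and Def. 4.6] -/
theorem isStrong_of_forall_predim_le_of_le (hH : IsStrong H) (hle : Λ ≤ Λ') (hΛ'H : Λ' ≤ H)
    (hfg : IsFG Λ Λ')
    (hmin : ∀ Λ'' : Submodule ℚ F, Λ' ≤ Λ'' → Λ'' ≤ H → IsFG Λ Λ'' →
      predim Λ Λ' ≤ predim Λ Λ'') :
    IsStrong Λ' := by
  intro X hX hfgX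
  have hfgΛX : IsFG Λ X := hfg.trans hfgX
  -- split along `Λ' ≤ X ⊓ H ≤ X`
  have h1 : Λ' ≤ X ⊓ H := le_inf hX hΛ'H
  have h2 : X ⊓ H ≤ X := inf_le_left
  have hadd := predim_add h1 h2 hfgX
  -- second term: minimality
  have hminXH : predim Λ Λ' ≤ predim Λ (X ⊓ H) := hmin _ h1 inf_le_right (hfgΛX.mono h2)
  have hΛ'XH : 0 ≤ predim Λ' (X ⊓ H) := by
    have := predim_add hle h1 (hfgΛX.mono h2)
    linarith
  -- first term: submodularity and `H ◁ F`
  have hfgXH : IsFG (X ⊓ H) X := hfgX.of_le_left h1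
  have hsub : predim H (X ⊔ H) ≤ predim (X ⊓ H) X := predim_sup_le X H hfgXH
  have hHX : 0 ≤ predim H (X ⊔ H) :=
    hH le_sup_right (isFG_sup_right.2 ((isFG_iff_isFG_inf X H).2 hfgXH))
  linarith

/-- **Existence of minimisers** of the predimension over a strong base: if `Λ ◁ F` and `P` is
a property of subspaces satisfied by some finitely generated extension `Λ' ≥ Λ`, there is a
finitely generated extension `Λ'' ≥ Λ'` satisfying `P` whose predimension over `Λ` is minimal
among all such (the predimension takes values in `ℕ` over a strong base). [folklore] -/
theorem IsStrong.exists_forall_predim_le (h : IsStrong Λ) (P : Submodule ℚ F → Prop)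
    (hle : Λ ≤ Λ') (hfg : IsFG Λ Λ') (hP : P Λ') :
    ∃ Λ'' : Submodule ℚ F, Λ' ≤ Λ'' ∧ IsFG Λ Λ'' ∧ P Λ'' ∧
      ∀ X : Submodule ℚ F, Λ' ≤ X → IsFG Λ X → P X → predim Λ Λ'' ≤ predim Λ X := by
  classical
  -- the set of achievable predimensions, as natural numbers
  have hex : ∃ n : ℕ, ∃ X : Submodule ℚ F, Λ' ≤ X ∧ IsFG Λ X ∧ P X ∧ predim Λ X = n :=
    ⟨(predim Λ Λ').toNat, Λ', le_rfl, hfg, hP, (Int.toNat_of_nonneg (h hle hfg)).symm⟩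
  obtain ⟨X, hX, hfgX, hPX, hn⟩ := Nat.find_spec hex
  refine ⟨X, hX, hfgX, hPX, fun Y hY hfgY hPY => ?_⟩
  have hY0 : 0 ≤ predim Λ Y := h (hle.trans hY) hfgY
  have hmin := Nat.find_min' hex ⟨Y, hY, hfgY, hPY, (Int.toNat_of_nonneg hY0).symm⟩
  rw [hn]
  calc ((Nat.find hex : ℕ) : ℤ) ≤ ((predim Λ Y).toNat : ℤ) := by exact_mod_cast hmin
    _ = predim Λ Y := Int.toNat_of_nonneg hY0

/-- **Hulls inside a strong subspace**: if `Λ ◁ F`, `H ◁ F` and `Λ ≤ Λ' ≤ H` with `Λ'` finitely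
generated over `Λ`, then `Λ'` extends to a finitely generated `D` with `Λ' ≤ D ≤ H` and `D ◁ F`
(Bays–Kirby 2018, Def. 4.6 and Lemma 4.5: the hull `⌈Λ'⌉` computed inside `H`).
[cite: BaysKirby2018ANT, Def. 4.6] -/
theorem IsStrong.exists_isStrong_of_le (h : IsStrong Λ) (hH : IsStrong H) (hle : Λ ≤ Λ')
    (hΛ'H : Λ' ≤ H) (hfg : IsFG Λ Λ') :
    ∃ D : Submodule ℚ F, Λ' ≤ D ∧ D ≤ H ∧ IsFG Λ D ∧ IsStrong D := by
  obtain ⟨D, hD, hfgD, hDH, hmin⟩ := h.exists_forall_predim_le (· ≤ H) hle hfg hΛ'H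
  exact ⟨D, hD, hDH, hfgD, isStrong_of_forall_predim_le_of_le hH (hle.trans hD) hDH hfgD
    fun X hX hXH hfgX => hmin X (hD.trans hX) hfgX hXH⟩

/-- **Hulls**: over a strong `Λ`, every finitely generated `Λ' ≥ Λ` extends to a finitely
generated strong `D ≥ Λ'` (Bays–Kirby 2018, Def. 4.6). [cite: BaysKirby2018ANT, Def. 4.6] -/
theorem IsStrong.exists_isStrong (h : IsStrong Λ) (hle : Λ ≤ Λ') (hfg : IsFG Λ Λ') :
    ∃ D : Submodule ℚ F, Λ' ≤ D ∧ IsFG Λ D ∧ IsStrong D := by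
  obtain ⟨D, hD, -, hfgD, hs⟩ := h.exists_isStrong_of_le isStrong_top hle le_top hfg
  exact ⟨D, hD, hfgD, hs⟩

/-! ### Simple extensions -/

/-- `td(Λ + ℚd / Λ)` is the relative rank of `{d, exp d}` over the generators of `Λ`.
[folklore] -/
theorem td_span_singleton (Λ : Submodule ℚ F) (d : F) :
    td Λ (Submodule.span ℚ {d}) = (algMatroid F).relRank (gens Λ) {d, exp d} := by
  refine le_antisymm ?_ ?_
  · refine (td_span_le_relRank Λ {d}).trans (le_of_eq ?_)
    rw [image_singleton, singleton_union, pair_comm]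
  · refine (algMatroid F).relRank_le_of_subset_closure _ ?_
    change {d, exp d} ⊆ acl (gens (Submodule.span ℚ {d}) ∪ gens Λ)
    refine (subset_acl _).trans' ?_
    intro b hb
    rcases hb with rfl | rfl
    · exact Or.inl (mem_gens_of_mem (Submodule.mem_span_singleton_self _))
    · exact Or.inl (exp_mem_gens (Submodule.mem_span_singleton_self _))

/-- `td(Λ + ℚd / Λ) ≤ 2`. [folklore] -/
theorem td_span_singleton_le (Λ : Submodule ℚ F) (d : F) : td Λ (Submodule.span ℚ {d}) ≤ 2 := by
  simpa using td_span_le Λ {d}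

/-- `δ(d/Λ) ≤ 1` for `d ∉ Λ`. [folklore] -/
theorem predim_span_singleton_le (hd : d ∉ Λ) : predim Λ (Submodule.span ℚ {d}) ≤ 1 := by
  rw [predim, ldim_span_singleton_of_not_mem hd]
  have h2 : (td Λ (Submodule.span ℚ {d})).toNat ≤ 2 := by
    have := td_span_singleton_le Λ d
    exact ENat.toNat_le_of_le_coe this
  omega

/-- If `d ∉ Λ` and `δ(d/Λ) = 1` then `td(d, exp d/Λ) = 2`. [folklore] -/
theorem td_span_singleton_eq_two (hd : d ∉ Λ) (h1 : predim Λ (Submodule.span ℚ {d}) = 1) :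
    td Λ (Submodule.span ℚ {d}) = 2 := by
  rw [predim, ldim_span_singleton_of_not_mem hd] at h1
  have hle := td_span_singleton_le Λ d
  have hne : td Λ (Submodule.span ℚ {d}) ≠ ⊤ := ne_top_of_le_ne_top (by decide) hle
  have h2 : (td Λ (Submodule.span ℚ {d})).toNat = 2 := by omega
  rw [← ENat.coe_toNat hne, h2]; rfl

/-- If `td(d, exp d/Λ) = 2` then `d` is transcendental over the Γ-subfield of `Λ` (i.e. not in
`acl (gens Λ)`) and `exp d` is transcendental over that field with `d` adjoined. [folklore] -/
theorem not_mem_acl_of_td_eq_two (h : td Λ (Submodule.span ℚ {d}) = 2) :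
    d ∉ acl (gens Λ) ∧ exp d ∉ acl (insert d (gens Λ)) := by
  rw [td_span_singleton] at h
  set M := algMatroid F
  constructor
  · intro hd
    have h0 : M.relRank (gens Λ) {d} = 0 :=
      M.relRank_eq_zero_of_subset_closure (singleton_subset_iff.2 hd)
    have h1 : M.relRank (gens Λ) {d, exp d} ≤ 1 := by
      rw [pair_comm]
      calc M.relRank (gens Λ) {exp d, d} ≤ M.relRank (gens Λ) {d} + 1 :=
            M.relRank_insert_le _ _ _
        _ = 1 := by rw [h0, zero_add]
    rw [h] at h1
    exact absurd h1 (by decide)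
  · intro he
    have h1 : M.relRank (gens Λ) {exp d, d} = M.relRank (gens Λ) {d} :=
      M.relRank_insert_eq_of_mem_closure (by rwa [singleton_union])
    have h2 : M.relRank (gens Λ) {d} ≤ 1 :=
      (M.relRank_le_encard_diff (gens Λ) {d}).trans
        ((encard_le_encard sdiff_subset).trans (by rw [encard_singleton]))
    rw [pair_comm, h1] at h
    rw [h] at h2
    exact absurd h2 (by decide)

/-! ### Generic elements over Γ-closed subspaces (Bays–Kirby Lemma 4.13) -/

/-- **Adjoining an element outside a Γ-closed subspace** (Bays–Kirby 2018, Lemma 4.13,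
exponential case: "if `A ◁ F` and `a ∈ F ∖ Γcl(A)` there is `α ∈ Γ(F)` … `δ(α/A) = 1`, and
`⟨Aα⟩ ◁ F`"; here `α = (d, exp d)`). If `D ◁ F`, `D ≤ H` with `H` Γ-closed in `F`, and
`d ∉ H`, then `D + ℚd ◁ F` and `δ(d/D) = 1`. Proof: for `X ⊇ D + ℚd` finitely generated,
`δ(X/D) = δ(X/X ∩ H) + δ(X ∩ H/D) ≥ δ(X + H/H) + 0 ≥ 1` (submodularity, `D ◁ F`, and `X + H`
is a proper finitely generated extension of the Γ-closed `H`), while `δ(d/D) ≤ 1`.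
[cite: BaysKirby2018ANT, Lemma 4.13] -/
theorem IsStrong.sup_span_singleton (hD : IsStrong D) (hH : IsGammaClosed H) (hDH : D ≤ H)
    (hd : d ∉ H) :
    IsStrong (D ⊔ Submodule.span ℚ {d}) ∧ predim D (Submodule.span ℚ {d}) = 1 := by
  have hdD : d ∉ D := fun h => hd (hDH h)
  have hfgd : IsFG D (Submodule.span ℚ ({d} : Set F)) := isFG_span_of_finite D (finite_singleton d)
  -- key estimate: every f.g. `X ⊇ D + ℚd` has `δ(X/D) ≥ 1`
  have key : ∀ X : Submodule ℚ F, D ⊔ Submodule.span ℚ {d} ≤ X → IsFG D X → 1 ≤ predim D X := by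
    intro X hX hfgX
    have h1 : D ≤ X ⊓ H := le_inf (le_sup_left.trans hX) hDH
    have h2 : X ⊓ H ≤ X := inf_le_left
    have hadd := predim_add h1 h2 hfgX
    have hsecond : 0 ≤ predim D (X ⊓ H) := hD h1 (hfgX.mono h2)
    have hfgXH : IsFG (X ⊓ H) X := hfgX.of_le_left h1
    have hsub : predim H (X ⊔ H) ≤ predim (X ⊓ H) X := predim_sup_le X H hfgXH
    have hne : X ⊔ H ≠ H := by
      intro heq
      have : d ∈ X ⊔ H := Submodule.mem_sup_left
        (hX (Submodule.mem_sup_right (Submodule.mem_span_singleton_self d)))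
      rw [heq] at this
      exact hd this
    have hfirst : 1 ≤ predim H (X ⊔ H) :=
      hH.one_le_predim le_sup_right (isFG_sup_right.2 ((isFG_iff_isFG_inf X H).2 hfgXH)) hne
    linarith
  have hup : predim D (Submodule.span ℚ {d}) ≤ 1 := predim_span_singleton_le hdD
  have hlow : 1 ≤ predim D (Submodule.span ℚ {d}) := by
    rw [← predim_sup_left]
    exact key _ le_rfl (isFG_sup_left.2 hfgd)
  have h1 : predim D (Submodule.span ℚ {d}) = 1 := le_antisymm hup hlow
  refine ⟨?_, h1⟩
  intro X hX hfgX
  have hfgDX : IsFG D X := (isFG_sup_left.2 hfgd).trans hfgX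
  have hadd := predim_add (le_sup_left : D ≤ D ⊔ Submodule.span ℚ {d}) hX hfgDX
  rw [predim_sup_left, h1] at hadd
  linarith [key X hX hfgDX]

end Strong

end GammaField

end Literature.NumberTheory.Transcendental
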